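/-
Copyright (c) 2026 the pub-hodgecm-mathlib formalisation cell (harness21).  Prover seat hodgecm-mathlib-F0P2-p06 (g13): road «S3-ram» (LEAD F0P3a-plan (g12); architect
A-p16 (g31); owner F0P3a-p06 (g15)), organ A′ (ii) (B4) G3⁗ «THE PREDICATE ν-BRIDGE AT DEPTH d»; 2026-09-02.
-/
import Literature.NumberTheory.Automorphic.UnitaryLatticeTreeRootStarNullIsotropicCountRamified   -- ★ p847330 (this seat, g12): G3′ the ν-bridge at depth 1 (null test); brings ★ R2b, ★ G3⁺, ★ G3″
import Literature.GroupTheory.SpecificGroups.OrthogonalThreeIsotropicParamsClassCount            -- ★ p847443 (this seat, g13): G3‴ the class split on the conic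
import HarnessLib

/-!
# The lattice graph of a hermitian space — THE PREDICATE ν-BRIDGE AT DEPTH `d` at a tamely ramified place: neighbours of a self-dual vertex whose line passes a residual
# square-class test `P(ᵗx̄ (J̄₀Ȳ) x̄)` ↔ normalised isotropic parameters passing it (Bruhat–Tits 1972 §10; Tits 1979 §3.5; Serre, *Trees* II.1.1; Kottwitz 1986 §3)

Topic `NumberTheory/Automorphic`; namespace `Literature.NumberTheory.Automorphic.UnitaryLatticeTree`.  THEOREMS ONLY (no definition, no instance, no notation, no named fact,
no `sorry`); kernel lane `--supports stmt-HodgeConjecture-24833`.  Cell `pub/hodgecm-mathlib` (D-0151), crux H413; road «S3-ram» (Literature seeding, count-neutral), organ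
A′ (ii) (B4) of the P-1-ram skeleton (architect A-p16 (g31)), part **G3⁗** — the CLASS ∕ DEPTH-`d` twin of ★ G3′ `UnitaryLatticeTreeRootStarNullIsotropicCountRamified` (p847330):
G3′ identifies, for `γ′ ≡ 1 (mod ϖ)` and `Ȳ = ϖ⁻¹(γ′ − 1) mod ϖ`, the neighbours of `L₀` passing the NULL test with the `Q_Ȳ`-null points of the residual conic.  The junction of
the tree-induction engine (★ `Rogawski1990/DepthZeroKappaTransferTypeOneRamifiedTreeInduction`, rows `hE hO hP`) needs the same bridge (i) at ANY depth `d` (leading term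
`Ȳ = ϖ^{−d}(γ′ − 1) mod ϖ`) and (ii) for ANY residual condition on the line that is a union of square classes (the CLASS of `Q_Ȳ(x̄)`, not only its vanishing) — the label of
the `q` grandchildren through a modular neighbour `(uκ)·N₁` is read off the residual value at the line `κe₀` (★ FILES E∕F∕H `UnitaryLatticeTreeFixedChild{Level,Class,Tokens}Ramified`,
F0P2-p01), their number per label is `q · #{lines passing}` (★ J6-mult p847357), and `#{lines passing}` is THIS file's left side; its right side is counted by ★ G3″ (null: `2 ∕ 1 ∕ q+1`)
and ★ G3‴ (class: `(q−1)∕2` each at rank two, `q ∕ 0` at rank one).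

DATUM-FREE ramified tokens as in ★ G3′ (`σ` a valuation-preserving involution, `σϖ = −ϖ`, residually trivial, `|2| = 1`, finite `𝓀`); the matrix `M` is ARBITRARY (consumer:
`M := u⁻¹γu − 1`), its leading term enters through an `𝒪`-valued `Y₀` with `Y₀ = (ϖ^d)⁻¹·M` entrywise (binder + hypothesis, no definition; this forces `|M_{ij}| ≤ |ϖ|^d`),
`Ȳ := Y₀ mod ϖ`; the test at an integral vector `x` is the RESIDUE of `(ϖ^d)⁻¹·B₀(x, Mx) ∈ 𝒪`, spelled `∃ t : 𝒪, ↑t = (ϖ^d)⁻¹·B₀(x, Mx) ∧ P (residue t)` (no subtype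
bookkeeping in statements); `P : 𝓀 → Prop` is any predicate INVARIANT UNDER NON-ZERO SQUARES (`P(c²t) ↔ P(t)`), the only kind that descends from vectors to lines.

* §1 RESIDUAL VALUE READING: **`exists_integer_eq_test_and_residue_eq`** (`residue((ϖ^d)⁻¹·B₀(x, Mx)) = ᵗx̄ (J̄₀Ȳ) x̄` — G3′ §1 read only its vanishing, at `d = 1`),
  `exists_integer_test_pred_iff` (the `∃ t` spelling ↔ `P(ᵗx̄(J̄₀Ȳ)x̄)`), the TOKEN DICTIONARY `exists_unit_v_sub_mul_sq_lt_one_iff_residue`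
  (`(∃ a₀, |a₀| = 1 ∧ |t − s·a₀²| < 1) ↔ ∃ ā ≠ 0, t̄ = s̄·ā²` — ★ FILE H's `CLS` token ↔ ★ G3‴'s token class) and `pred_form_smul_iff` (square classes descend to lines).
* §2 THE BRIDGE: `exists_integer_test_pred_iff_of_forall_v_B₀_lt_one_iff` (the test at any primitive exactly-isotropic `x` cutting out the hyperplane of the normalised `x_p` is
  `P(Q_Ȳ(x̄_p))` — frame independence), **`ncard_neighborSet_root_pred_eq_natCard`**:
  `#{w ∈ star(L₀) | ∃ κ ∈ K₀, w = κ·N₁ ∧ P(residue((ϖ^d)⁻¹·B₀(κe₀, M·κe₀)))} = #{p : P(ᵗx̄_p(J̄₀Ȳ)x̄_p)}` (★ R2b's bijection `p ↦ N_{x_p}`), and its transport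
  **`ncard_neighborSet_pred_eq_natCard`** to `u·L₀` (frames `uκ`).
* §3 COROLLARIES over ★ G3″∕G3‴ under the residual hypotheses on `Ȳ` (`J̄₀`-symmetric; `Ȳ³ = 0 ≠ Ȳ²`, resp. `O(J̄₀)`-conjugate to `N(c)`): the null predicate gives `2` (resp. `1`)
  neighbours (`ncard_neighborSet_root_null_eq_two_of_sq_ne_zero`, `…_eq_one_of_conj_cornerSymmetric` — G3′'s `ν` at depth `d`), the class predicate `χ(c₀·) = σ` gives
  **`2·#{…} = q − 1`** (`two_mul_ncard_neighborSet_root_quadraticChar_eq_of_sq_ne_zero`) resp. `q ∕ 0` (`ncard_neighborSet_root_quadraticChar_eq_ite_of_conj_cornerSymmetric`).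

HONEST LABEL: HC_CM is proved only modulo the 2 remaining named inputs (hLiu418 24832, h413 24833) until rung 0 closes; nothing printed is asserted here (residual bookkeeping
over ★ results); «S3-ram» has no books consequence.

## References
* [BruhatTits1972] F. Bruhat, J. Tits, *Groupes réductifs sur un corps local I*, Publ. Math. IHÉS 41 (1972), §10 (the star of a vertex = the residual building; here the conic
  of isotropic points of `(𝓀³, J̄₀)`).
* [Tits1979] J. Tits, *Reductive groups over local fields*, PSPM 33.1 (1979), §2.4, §3.5 (ramified `U(3)`; reduction mod `𝔭`, congruence filtration).
* [Serre1980Trees] J.-P. Serre, *Trees* (1980), Ch. II §1.1 (neighbours of a lattice = points of the residual projective line∕conic).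
* [Kottwitz1986] R. E. Kottwitz, *Base change for unit elements of Hecke algebras*, Compositio Math. 60 (1986), §3 (counting fixed lattices by residual data).
-/

set_option autoImplicit false

noncomputable section

open scoped Valued WithZero Matrix MatrixGroups

namespace Literature.NumberTheory.Automorphic.UnitaryLatticeTree

open Literature.NumberTheory.Automorphic Literature.NumberTheory.Automorphic.HermitianLattice
open Literature.NumberTheory.Automorphic.CartanUnique Literature.NumberTheory.Automorphic.UnitaryGroup
open Literature.GroupTheory.SpecificGroups

variable {K : Type*} [Field K] [Valued K ℤᵐ⁰] {σ : K →+* K} {ϖ : K}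

/-! ## §1 Residual VALUE reading of the depth-`d` test; the token dictionary -/

/-- **RESIDUAL VALUE OF THE TEST**: for `x ∈ 𝒪³` (given as `x₀ : Fin 3 → 𝒪`) and `Y₀ = (ϖ^d)⁻¹·M` entrywise in `𝒪`, the number `(ϖ^d)⁻¹·B₀(x, Mx)` is an element `t` of `𝒪` with
**`residue t = ᵗx̄ (J̄₀ Ȳ) x̄`**, `Ȳ = Y₀ mod ϖ` (`σ̄ = id`). ★ G3′'s `v_test_lt_one_iff_residue` is the case `d = 1`, `t̄ = 0`. [cite: Tits1979, §3.5] [cite: Kottwitz1986, §3] -/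
theorem exists_integer_eq_test_and_residue_eq (hvσ : ∀ a, Valued.v (σ a) = Valued.v a) (hres : ∀ x : K, Valued.v x ≤ 1 → Valued.v (σ x - x) < 1)
    (hϖ0 : ϖ ≠ 0) {d : ℕ} (M : Matrix (Fin 3) (Fin 3) K) (Y₀ : Matrix (Fin 3) (Fin 3) 𝒪[K])
    (hY₀ : ∀ i j, ((Y₀ i j : 𝒪[K]) : K) = (ϖ ^ d)⁻¹ * M i j) (x₀ : Fin 3 → 𝒪[K]) :
    ∃ t : 𝒪[K], (t : K) = (ϖ ^ d)⁻¹ * B₀ σ 3 (fun i => (x₀ i : K)) (M *ᵥ fun i => (x₀ i : K)) ∧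
      IsLocalRing.residue 𝒪[K] t = (fun i => IsLocalRing.residue 𝒪[K] (x₀ i)) ⬝ᵥ
        ((((StdForm.antidiagonal 3).over 𝓀[K]) * Y₀.map (IsLocalRing.residue 𝒪[K])) *ᵥ fun i => IsLocalRing.residue 𝒪[K] (x₀ i)) := by
  have hϖd : (ϖ ^ d : K) ≠ 0 := pow_ne_zero _ hϖ0
  -- `M = ϖ^d • Y₀`, so `(ϖ^d)⁻¹ B₀(x, Mx) = B₀(x, Y₀x)`
  have hM : M = (ϖ ^ d) • (Y₀.map (fun y : 𝒪[K] => (y : K))) := by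
    ext i j
    rw [Matrix.smul_apply, Matrix.map_apply, hY₀, smul_eq_mul, mul_inv_cancel_left₀ hϖd]
  have hmv : M *ᵥ (fun i => (x₀ i : K)) = (ϖ ^ d) • ((Y₀.map (fun y : 𝒪[K] => (y : K))) *ᵥ (fun i => (x₀ i : K))) := by
    rw [hM, Matrix.smul_mulVec]
  have hmap : (Y₀.map (fun y : 𝒪[K] => (y : K))) *ᵥ (fun i => (x₀ i : K)) = fun j => ((Y₀ *ᵥ x₀) j : K) := by
    ext j
    simp [Matrix.mulVec, dotProduct]
  refine ⟨∑ i, (⟨σ (x₀ i : K), map_coe_mem_integer hvσ (x₀ i)⟩ : 𝒪[K]) * (Y₀ *ᵥ x₀) (Fin.rev i), ?_, ?_⟩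
  · rw [hmv, map_smul, smul_eq_mul, inv_mul_cancel_left₀ hϖd, hmap, B₀_apply]
    push_cast
    rfl
  · have hres' : (Y₀.map (IsLocalRing.residue 𝒪[K])) *ᵥ (fun i => IsLocalRing.residue 𝒪[K] (x₀ i)) = fun j => IsLocalRing.residue 𝒪[K] ((Y₀ *ᵥ x₀) j) := by
      ext j
      simp [Matrix.mulVec, dotProduct, map_sum]
    rw [map_sum, ← Matrix.mulVec_mulVec, dotProduct_antidiagonal_three_mulVec_eq_sum, hres']
    simp only [map_mul, residue_map_sigma_eq hvσ hres]

/-- **THE `∃ t` SPELLING OF A RESIDUAL CONDITION ON THE TEST**: for any predicate `P` on `𝓀`, «`(ϖ^d)⁻¹·B₀(x, Mx)` is an integer whose residue satisfies `P`» iff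
`P(ᵗx̄ (J̄₀Ȳ) x̄)`. [cite: Tits1979, §3.5] [cite: Kottwitz1986, §3] -/
theorem exists_integer_test_pred_iff (hvσ : ∀ a, Valued.v (σ a) = Valued.v a) (hres : ∀ x : K, Valued.v x ≤ 1 → Valued.v (σ x - x) < 1)
    (hϖ0 : ϖ ≠ 0) {d : ℕ} (M : Matrix (Fin 3) (Fin 3) K) (Y₀ : Matrix (Fin 3) (Fin 3) 𝒪[K])
    (hY₀ : ∀ i j, ((Y₀ i j : 𝒪[K]) : K) = (ϖ ^ d)⁻¹ * M i j) (x₀ : Fin 3 → 𝒪[K]) (P : 𝓀[K] → Prop) :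
    (∃ t : 𝒪[K], (t : K) = (ϖ ^ d)⁻¹ * B₀ σ 3 (fun i => (x₀ i : K)) (M *ᵥ fun i => (x₀ i : K)) ∧ P (IsLocalRing.residue 𝒪[K] t)) ↔
      P ((fun i => IsLocalRing.residue 𝒪[K] (x₀ i)) ⬝ᵥ
        ((((StdForm.antidiagonal 3).over 𝓀[K]) * Y₀.map (IsLocalRing.residue 𝒪[K])) *ᵥ fun i => IsLocalRing.residue 𝒪[K] (x₀ i))) := by
  obtain ⟨t₀, ht₀, hres₀⟩ := exists_integer_eq_test_and_residue_eq hvσ hres hϖ0 M Y₀ hY₀ x₀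
  constructor
  · rintro ⟨t, ht, hP⟩
    have htt : t = t₀ := Subtype.ext (by rw [ht, ht₀])
    rwa [htt, hres₀] at hP
  · intro hP
    exact ⟨t₀, ht₀, by rw [hres₀]; exact hP⟩

/-- **THE TOKEN DICTIONARY**: for `t, s ∈ 𝒪`, «`t ≡ s·a₀²` to first order for some unit `a₀`» (the `CLS` token of ★ FILE H, valuation level) iff «`t̄ = s̄·ā²` for some `ā ≠ 0`» (the
token class of ★ G3‴, residue level). [cite: Serre1980Trees, II.1.1] [cite: Kottwitz1986, §3] -/
theorem exists_unit_v_sub_mul_sq_lt_one_iff_residue (t s : 𝒪[K]) :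
    (∃ a₀ : K, Valued.v a₀ = 1 ∧ Valued.v ((t : K) - (s : K) * a₀ ^ 2) < 1) ↔
      ∃ a : 𝓀[K], a ≠ 0 ∧ IsLocalRing.residue 𝒪[K] t = IsLocalRing.residue 𝒪[K] s * a ^ 2 := by
  constructor
  · rintro ⟨a₀, ha₀, hlt⟩
    have ha₀O : a₀ ∈ 𝒪[K] := (Valuation.mem_integer_iff _ _).2 ha₀.le
    refine ⟨IsLocalRing.residue 𝒪[K] ⟨a₀, ha₀O⟩, fun h0 => ?_, ?_⟩
    · rw [residue_eq_zero_iff_v_lt_one] at h0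
      exact (ne_of_lt h0) ha₀
    · rw [← sub_eq_zero, ← map_pow, ← map_mul, ← map_sub, residue_eq_zero_iff_v_lt_one]
      push_cast
      exact hlt
  · rintro ⟨a, ha, heq⟩
    obtain ⟨a₀, rfl⟩ := IsLocalRing.residue_surjective a
    have ha₀ : Valued.v (a₀ : K) = 1 := by
      refine le_antisymm a₀.2 (not_lt.1 fun hlt => ha ?_)
      rw [residue_eq_zero_iff_v_lt_one]; exact hlt
    refine ⟨a₀, ha₀, ?_⟩
    have h : IsLocalRing.residue 𝒪[K] (t - s * a₀ ^ 2) = 0 := by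
      rw [map_sub, map_mul, map_pow, heq, sub_self]
    rw [residue_eq_zero_iff_v_lt_one] at h
    push_cast at h
    exact h

omit [Valued K ℤᵐ⁰] in
/-- **SQUARE CLASSES DESCEND TO LINES**: for a predicate `P` invariant under non-zero squares and `c ≠ 0`, `P(ᵗ(cx)A(cx)) ↔ P(ᵗxAx)` (any field, any `A`).
[cite: BruhatTits1972, §10] -/
theorem pred_form_smul_iff {F : Type*} [Field F] (A : Matrix (Fin 3) (Fin 3) F) (P : F → Prop) (hP : ∀ c t : F, c ≠ 0 → (P (c * c * t) ↔ P t))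
    {c : F} (hc : c ≠ 0) (x : Fin 3 → F) : P ((c • x) ⬝ᵥ (A *ᵥ (c • x))) ↔ P (x ⬝ᵥ (A *ᵥ x)) := by
  rw [dotProduct_smul_mulVec_smul]
  exact hP c _ hc

/-! ## §2 The bridge: neighbours passing a residual square-class test ↔ normalised parameters passing it -/

/-- **FRAME INDEPENDENCE — THE TEST TRANSFERS TO THE NORMALISED REPRESENTATIVE**: if `x ∈ 𝒪³` is primitive and exactly isotropic and cuts out the same residual hyperplane as the
normalised vector `x_p` (`x_∞ = e₂`, `x_(ā,b̄) = (1, lift ā, lift b̄)`), then for every square-class-invariant `P` the depth-`d` test at `x` reads `P(ᵗx̄_p (J̄₀Ȳ) x̄_p)`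
(`x ≡ c·x_{p(x)}` by ★ R2b's normal form, `p(x) = p` by uniqueness, `c̄² ≠ 0` drops by invariance). [cite: Tits1979, §3.5] [cite: BruhatTits1972, §10] -/
theorem exists_integer_test_pred_iff_of_forall_v_B₀_lt_one_iff (hvσ : ∀ a, Valued.v (σ a) = Valued.v a) (hres : ∀ x : K, Valued.v x ≤ 1 → Valued.v (σ x - x) < 1)
    (hϖ : Valued.v ϖ = WithZero.exp (-1 : ℤ)) (lift : 𝓀[K] → 𝒪[K]) (hlift : ∀ a, IsLocalRing.residue 𝒪[K] (lift a) = a)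
    {d : ℕ} (M : Matrix (Fin 3) (Fin 3) K) (Y₀ : Matrix (Fin 3) (Fin 3) 𝒪[K]) (hY₀ : ∀ i j, ((Y₀ i j : 𝒪[K]) : K) = (ϖ ^ d)⁻¹ * M i j)
    (P : 𝓀[K] → Prop) (hP : ∀ c t : 𝓀[K], c ≠ 0 → (P (c * c * t) ↔ P t))
    {x : Fin 3 → K} (hx : x ∈ stdLattice K 3) (hunit : ∃ j, Valued.v (x j) = 1) (hiso : B₀ σ 3 x x = 0)
    (p : Option {p : 𝓀[K] × 𝓀[K] // p.2 + (RingHom.id 𝓀[K]) p.2 + p.1 * (RingHom.id 𝓀[K]) p.1 = 0})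
    (hiff : ∀ y ∈ stdLattice K 3,
      (Valued.v (B₀ σ 3 x y) < 1 ↔ Valued.v (B₀ σ 3 (p.elim (Pi.single 2 1) fun q => ![(1 : K), (lift q.1.1 : K), (lift q.1.2 : K)]) y) < 1)) :
    (∃ t : 𝒪[K], (t : K) = (ϖ ^ d)⁻¹ * B₀ σ 3 x (M *ᵥ x) ∧ P (IsLocalRing.residue 𝒪[K] t)) ↔
      P ((p.elim (Pi.single 2 1) fun q => ![(1 : 𝓀[K]), q.1.1, q.1.2]) ⬝ᵥ
        ((((StdForm.antidiagonal 3).over 𝓀[K]) * Y₀.map (IsLocalRing.residue 𝒪[K])) *ᵥ (p.elim (Pi.single 2 1) fun q => ![(1 : 𝓀[K]), q.1.1, q.1.2]))) := by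
  have hϖ0 : ϖ ≠ 0 := uniformizer_ne_zero hϖ
  have hσO : ∀ y : 𝒪[K], σ y ∈ 𝒪[K] := map_coe_mem_integer hvσ
  have hσk : ∀ y : 𝒪[K], IsLocalRing.residue 𝒪[K] ⟨σ y, hσO y⟩ = (RingHom.id 𝓀[K]) (IsLocalRing.residue 𝒪[K] y) :=
    fun y => by rw [RingHom.id_apply]; exact residue_map_sigma_eq hvσ hres y
  -- STEP 1: `x ≡ c·x_p (mod 𝔪)` for a unit `c` (normal form + uniqueness of the normalised representative)
  have hc : ∃ c : K, Valued.v c = 1 ∧ ∀ i, Valued.v (x i - c * (p.elim (Pi.single 2 1) fun q => ![(1 : K), (lift q.1.1 : K), (lift q.1.2 : K)]) i) < 1 := by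
    rcases exists_unit_congr_normalForm_of_isotropic_of_v hvσ hσO (RingHom.id 𝓀[K]) hσk lift hlift hx hunit hiso with hc | ⟨p'', hc⟩
    · have hiff' : ∀ y ∈ stdLattice K 3, (Valued.v (B₀ σ 3 x y) < 1 ↔ Valued.v (B₀ σ 3 (Pi.single 2 1 : Fin 3 → K) y) < 1) :=
        forall_v_B₀_lt_one_iff_of_exists_unit_congr hvσ hc
      have hp : p = none := by
        refine normalForm_eq_of_forall_v_B₀_lt_one_iff hvσ (RingHom.id 𝓀[K]) lift hlift (p := p) (p' := none) fun y hy => ?_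
        rw [← hiff y hy, hiff' y hy]; rfl
      subst hp
      exact hc
    · have hiff' : ∀ y ∈ stdLattice K 3, (Valued.v (B₀ σ 3 x y) < 1 ↔
          Valued.v (B₀ σ 3 (![(1 : K), (lift p''.1.1 : K), (lift p''.1.2 : K)] : Fin 3 → K) y) < 1) :=
        forall_v_B₀_lt_one_iff_of_exists_unit_congr hvσ hc
      have hp : p = some p'' := by
        refine normalForm_eq_of_forall_v_B₀_lt_one_iff hvσ (RingHom.id 𝓀[K]) lift hlift (p := p) (p' := some p'') fun y hy => ?_
        rw [← hiff y hy, hiff' y hy]; rfl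
      subst hp
      exact hc
  obtain ⟨c, hc1, hcong⟩ := hc
  -- STEP 2: integral models and their residues
  set x₀ : Fin 3 → 𝒪[K] := fun i => ⟨x i, (Valuation.mem_integer_iff _ _).2 (hx i)⟩ with hx₀
  have ex : x = fun i => (x₀ i : K) := funext fun _ => rfl
  let xO : Fin 3 → 𝒪[K] := p.elim (Pi.single 2 1) fun q => ![(1 : 𝒪[K]), lift q.1.1, lift q.1.2]
  have hxO : (fun i => ((xO i : 𝒪[K]) : K)) = p.elim (Pi.single 2 1) fun q => ![(1 : K), (lift q.1.1 : K), (lift q.1.2 : K)] := by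
    rcases p with _ | q
    · funext i; change ((((Pi.single 2 1 : Fin 3 → 𝒪[K]) i) : 𝒪[K]) : K) = (Pi.single 2 1 : Fin 3 → K) i
      fin_cases i <;> simp
    · funext i; change (((![(1 : 𝒪[K]), lift q.1.1, lift q.1.2] : Fin 3 → 𝒪[K]) i : 𝒪[K]) : K) = (![(1 : K), (lift q.1.1 : K), (lift q.1.2 : K)] : Fin 3 → K) i
      fin_cases i <;> simp
  have hxObar : (fun i => IsLocalRing.residue 𝒪[K] (xO i)) = p.elim (Pi.single 2 1) fun q => ![(1 : 𝓀[K]), q.1.1, q.1.2] := by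
    rcases p with _ | q
    · funext i; change IsLocalRing.residue 𝒪[K] ((Pi.single 2 1 : Fin 3 → 𝒪[K]) i) = (Pi.single 2 1 : Fin 3 → 𝓀[K]) i
      fin_cases i <;> simp
    · funext i; change IsLocalRing.residue 𝒪[K] ((![(1 : 𝒪[K]), lift q.1.1, lift q.1.2] : Fin 3 → 𝒪[K]) i) = (![(1 : 𝓀[K]), q.1.1, q.1.2] : Fin 3 → 𝓀[K]) i
      fin_cases i <;> simp [hlift]
  have cO : c ∈ 𝒪[K] := (Valuation.mem_integer_iff _ _).2 hc1.le
  have hbar : (fun i => IsLocalRing.residue 𝒪[K] (x₀ i)) = IsLocalRing.residue 𝒪[K] ⟨c, cO⟩ • (fun i => IsLocalRing.residue 𝒪[K] (xO i)) := by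
    funext i
    rw [Pi.smul_apply, smul_eq_mul, ← map_mul, ← sub_eq_zero, ← map_sub, residue_eq_zero_iff_v_lt_one]
    have hi := hcong i
    rw [← hxO] at hi
    exact hi
  have hc0 : IsLocalRing.residue 𝒪[K] ⟨c, cO⟩ ≠ 0 := by
    rw [Ne, residue_eq_zero_iff_v_lt_one]
    exact fun hlt => (ne_of_lt hlt) hc1
  -- STEP 3: read the test residually at `x`, rescale by `c̄²`
  rw [ex, exists_integer_test_pred_iff hvσ hres hϖ0 M Y₀ hY₀ x₀ P, hbar, pred_form_smul_iff _ P hP hc0, hxObar]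

/-- **THE PREDICATE ν-BRIDGE AT THE ROOT.**  For any matrix `M` with depth-`d` leading term `Y₀ = (ϖ^d)⁻¹·M ∈ M₃(𝒪)`, `Ȳ = Y₀ mod ϖ`, and any residual predicate `P` invariant under
non-zero squares: the number of neighbours `w = κ·N₁` (`κ ∈ K₀`) of the root `L₀` whose line `κe₀` passes the test «`(ϖ^d)⁻¹·B₀(κe₀, M·κe₀)` has residue in `P`» (for SOME,
equivalently ANY, frame `κ` of `w` — frame independence above) equals the number of NORMALISED ISOTROPIC PARAMETERS `p ∈ {∞} ⊔ {(ā,b̄) : 2b̄ + ā² = 0}` with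
**`P(ᵗx̄_p (J̄₀Ȳ) x̄_p)`** (★ R2b's bijection `p ↦ N_{x_p}`). [cite: BruhatTits1972, §10] [cite: Tits1979, §2.4, §3.5] [cite: Serre1980Trees, II.1.1] [cite: Kottwitz1986, §3] -/
theorem ncard_neighborSet_root_pred_eq_natCard (hσ : ∀ x, σ (σ x) = x) (hvσ : ∀ a, Valued.v (σ a) = Valued.v a) (hσϖ : σ ϖ = -ϖ)
    (hϖ : Valued.v ϖ = WithZero.exp (-1 : ℤ)) (hres : ∀ x : K, Valued.v x ≤ 1 → Valued.v (σ x - x) < 1) (h2 : Valued.v (2 : K) = 1) [Finite 𝓀[K]]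
    {d : ℕ} (M : Matrix (Fin 3) (Fin 3) K) (Y₀ : Matrix (Fin 3) (Fin 3) 𝒪[K]) (hY₀ : ∀ i j, ((Y₀ i j : 𝒪[K]) : K) = (ϖ ^ d)⁻¹ * M i j)
    (P : 𝓀[K] → Prop) (hP : ∀ c t : 𝓀[K], c ≠ 0 → (P (c * c * t) ↔ P t)) :
    {w | w ∈ (latticeGraph σ ϖ ((StdForm.antidiagonal 3).over K)).neighborSet ⟨stdLattice K 3, 0, isSelfDualLattice_stdLattice_three_of_v hϖ⟩ ∧
        ∃ κ : unitaryGroupOfForm σ ((StdForm.antidiagonal 3).over K), κ ∈ unitaryInt σ ((StdForm.antidiagonal 3).over K) ∧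
          w.1 = mapGL (κ : GL (Fin 3) K) (latt (Matrix.diagonal ![(1 : K), 1, ϖ])) ∧
          ∃ t : 𝒪[K], (t : K) = (ϖ ^ d)⁻¹ * B₀ σ 3 (((κ : GL (Fin 3) K) : Matrix (Fin 3) (Fin 3) K) *ᵥ (Pi.single 0 1))
              (M *ᵥ (((κ : GL (Fin 3) K) : Matrix (Fin 3) (Fin 3) K) *ᵥ (Pi.single 0 1))) ∧ P (IsLocalRing.residue 𝒪[K] t)}.ncard =
      Nat.card {p : Option {p : 𝓀[K] × 𝓀[K] // p.2 + (RingHom.id 𝓀[K]) p.2 + p.1 * (RingHom.id 𝓀[K]) p.1 = 0} //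
        P ((p.elim (Pi.single 2 1) fun q => ![(1 : 𝓀[K]), q.1.1, q.1.2]) ⬝ᵥ
          ((((StdForm.antidiagonal 3).over 𝓀[K]) * Y₀.map (IsLocalRing.residue 𝒪[K])) *ᵥ (p.elim (Pi.single 2 1) fun q => ![(1 : 𝓀[K]), q.1.1, q.1.2])))} := by
  classical
  have hϖ0 : ϖ ≠ 0 := uniformizer_ne_zero hϖ
  have hlt1 : ∀ z : K, Valued.v z < 1 ↔ Valued.v z ≤ Valued.v ϖ := fun z => by rw [hϖ]; exact v_lt_one_iff z
  have h20 : (2 : K) ≠ 0 := fun h => by rw [h, map_zero] at h2; exact zero_ne_one h2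
  have htrace : ∃ t : K, Valued.v t ≤ 1 ∧ t + σ t = 1 :=
    ⟨2⁻¹, by rw [map_inv₀, h2, inv_one], by rw [map_inv₀, map_ofNat]; field_simp; norm_num⟩
  have hN₁ := isVertexLattice_two_N₁_of_neg (σ := σ) hσϖ hϖ
  obtain ⟨lift, hlift⟩ : ∃ lift : 𝓀[K] → 𝒪[K], ∀ a, IsLocalRing.residue 𝒪[K] (lift a) = a :=
    ⟨Function.surjInv IsLocalRing.residue_surjective, Function.surjInv_eq IsLocalRing.residue_surjective⟩
  have hσO : ∀ x : 𝒪[K], σ x ∈ 𝒪[K] := map_coe_mem_integer hvσ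
  have hσk : ∀ y : 𝒪[K], IsLocalRing.residue 𝒪[K] ⟨σ y, hσO y⟩ = (RingHom.id 𝓀[K]) (IsLocalRing.residue 𝒪[K] y) :=
    fun y => by rw [RingHom.id_apply]; exact residue_map_sigma_eq hvσ hres y
  -- the normalised vectors over `K`
  let xOf : Option {p : 𝓀[K] × 𝓀[K] // p.2 + (RingHom.id 𝓀[K]) p.2 + p.1 * (RingHom.id 𝓀[K]) p.1 = 0} → (Fin 3 → K) := fun p =>
    p.elim (Pi.single 2 1) fun q => ![(1 : K), (lift q.1.1 : K), (lift q.1.2 : K)]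
  have hxOf : ∀ p, xOf p = p.elim (Pi.single 2 1) fun q => ![(1 : K), (lift q.1.1 : K), (lift q.1.2 : K)] := fun _ => rfl
  have hxOf_none : xOf none = Pi.single 2 1 := rfl
  have hxOf_some : ∀ q, xOf (some q) = ![(1 : K), (lift q.1.1 : K), (lift q.1.2 : K)] := fun _ => rfl
  have hxL : ∀ p, xOf p ∈ stdLattice K 3 := by
    rintro (_ | q)
    · rw [hxOf_none]; exact single_mem_stdLattice 2
    · rw [hxOf_some]; exact vec_mem_stdLattice _ _
  have hxu : ∀ p, ∃ j, Valued.v (xOf p j) = 1 := by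
    rintro (_ | q)
    · exact ⟨2, by rw [hxOf_none]; simp⟩
    · exact ⟨0, by rw [hxOf_some]; simp⟩
  have hxiso : ∀ p, Valued.v (B₀ σ 3 (xOf p) (xOf p)) < 1 := by
    rintro (_ | q)
    · rw [hxOf_none, B₀_single_left, show Fin.rev (2 : Fin 3) = 0 from rfl]; simp
    · rw [hxOf_some]
      refine v_B₀_vec_self_lt_one hσO (RingHom.id 𝓀[K]) hσk ?_
      rw [hlift, hlift]; exact q.2
  -- the vertices `N_{x_p}` (★ R2b)
  choose f hf using fun p => exists_mem_neighborSet_root_forall_mem_iff_of_trace hσ hvσ hϖ htrace hN₁ (hxL p) (hxu p) (hxiso p)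
  have hfiff : ∀ p, ∀ y ∈ stdLattice K 3, (y ∈ (f p).1 ↔ Valued.v (B₀ σ 3 (xOf p) y) < 1) := fun p y hy => by
    rw [(hf p).2 y]; exact ⟨fun h => h.2, fun h => ⟨hy, h⟩⟩
  -- injectivity of `p ↦ f p`
  have hinj : ∀ p p', f p = f p' → p = p' := by
    intro p p' hEq
    refine normalForm_eq_of_forall_v_B₀_lt_one_iff hvσ (RingHom.id 𝓀[K]) lift hlift fun y hy => ?_
    rw [← hxOf, ← hxOf, ← hfiff p y hy, ← hfiff p' y hy, hEq]
  -- surjectivity of `p ↦ f p`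
  have hsurj : ∀ w ∈ (latticeGraph σ ϖ ((StdForm.antidiagonal 3).over K)).neighborSet ⟨stdLattice K 3, 0, isSelfDualLattice_stdLattice_three_of_v hϖ⟩, ∃ p, f p = w := by
    intro w hw
    obtain ⟨x, hx, hunit, hiso, hmem⟩ := exists_isotropic_forall_mem_iff_of_mem_neighborSet_root_of_trace hσ hvσ hϖ htrace hN₁ hw
    have key : ∀ p, (∃ c : K, Valued.v c = 1 ∧ ∀ i, Valued.v (x i - c * xOf p i) < 1) → f p = w := fun p hc => by
      refine eq_of_forall_mem_iff fun y => ?_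
      rw [(hf p).2 y, hmem y]
      exact and_congr_right fun hy => (forall_v_B₀_lt_one_iff_of_exists_unit_congr hvσ hc y hy).symm
    rcases exists_unit_congr_normalForm_of_isotropic_of_v hvσ hσO (RingHom.id 𝓀[K]) hσk lift hlift hx hunit hiso with hc | ⟨p, hc⟩
    · exact ⟨none, key none (by rw [hxOf_none]; exact hc)⟩
    · exact ⟨some p, key (some p) (by rw [hxOf_some]; exact hc)⟩
  -- the hyperplane of a frame `κ` of `f p` is that of `x_p`
  have hframe : ∀ p (κ : unitaryGroupOfForm σ ((StdForm.antidiagonal 3).over K)), κ ∈ unitaryInt σ ((StdForm.antidiagonal 3).over K) →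
      (f p).1 = mapGL (κ : GL (Fin 3) K) (latt (Matrix.diagonal ![(1 : K), 1, ϖ])) →
      ∀ y ∈ stdLattice K 3, (Valued.v (B₀ σ 3 (((κ : GL (Fin 3) K) : Matrix (Fin 3) (Fin 3) K) *ᵥ (Pi.single 0 1)) y) < 1 ↔
        Valued.v (B₀ σ 3 (p.elim (Pi.single 2 1) fun q => ![(1 : K), (lift q.1.1 : K), (lift q.1.2 : K)]) y) < 1) := by
    intro p κ hκ hwκ y hy
    have hwx' : y ∈ (f p).1 ↔ Valued.v (B₀ σ 3 (((κ : GL (Fin 3) K) : Matrix (Fin 3) (Fin 3) K) *ᵥ (Pi.single 0 1)) y) < 1 := by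
      rw [hwκ, mem_mapGL_N₁_iff hκ hϖ0 hy, hlt1]
    rw [← hwx', ← hxOf, hfiff p y hy]
  -- KEY: `f p` passes the `P`-test (in some frame) iff `P(Q_Ȳ(x̄_p))`
  have hkey : ∀ p, (∃ κ : unitaryGroupOfForm σ ((StdForm.antidiagonal 3).over K), κ ∈ unitaryInt σ ((StdForm.antidiagonal 3).over K) ∧
        (f p).1 = mapGL (κ : GL (Fin 3) K) (latt (Matrix.diagonal ![(1 : K), 1, ϖ])) ∧
        ∃ t : 𝒪[K], (t : K) = (ϖ ^ d)⁻¹ * B₀ σ 3 (((κ : GL (Fin 3) K) : Matrix (Fin 3) (Fin 3) K) *ᵥ (Pi.single 0 1))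
            (M *ᵥ (((κ : GL (Fin 3) K) : Matrix (Fin 3) (Fin 3) K) *ᵥ (Pi.single 0 1))) ∧ P (IsLocalRing.residue 𝒪[K] t)) ↔
      P ((p.elim (Pi.single 2 1) fun q => ![(1 : 𝓀[K]), q.1.1, q.1.2]) ⬝ᵥ
        ((((StdForm.antidiagonal 3).over 𝓀[K]) * Y₀.map (IsLocalRing.residue 𝒪[K])) *ᵥ (p.elim (Pi.single 2 1) fun q => ![(1 : 𝓀[K]), q.1.1, q.1.2]))) := by
    intro p
    constructor
    · rintro ⟨κ, hκ, hwκ, ht⟩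
      obtain ⟨hx'L, hx'iso, hx'unit⟩ := firstColumn_props (K := K) hκ
      exact (exists_integer_test_pred_iff_of_forall_v_B₀_lt_one_iff hvσ hres hϖ lift hlift M Y₀ hY₀ P hP hx'L hx'unit hx'iso p (hframe p κ hκ hwκ)).1 ht
    · intro hPp
      obtain ⟨κ, hκ, hwκ⟩ := (mem_neighborSet_root_iff_exists_mem_unitaryInt_of_trace hσ hvσ hϖ htrace hN₁ (f p)).1 (hf p).1
      obtain ⟨hx'L, hx'iso, hx'unit⟩ := firstColumn_props (K := K) hκ
      exact ⟨κ, hκ, hwκ, (exists_integer_test_pred_iff_of_forall_v_B₀_lt_one_iff hvσ hres hϖ lift hlift M Y₀ hY₀ P hP hx'L hx'unit hx'iso p (hframe p κ hκ hwκ)).2 hPp⟩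
  -- the restricted bijection
  rw [← Nat.card_coe_set_eq]
  refine (Nat.card_congr (Equiv.ofBijective
    (fun p : {p : Option {p : 𝓀[K] × 𝓀[K] // p.2 + (RingHom.id 𝓀[K]) p.2 + p.1 * (RingHom.id 𝓀[K]) p.1 = 0} //
        P ((p.elim (Pi.single 2 1) fun q => ![(1 : 𝓀[K]), q.1.1, q.1.2]) ⬝ᵥ
          ((((StdForm.antidiagonal 3).over 𝓀[K]) * Y₀.map (IsLocalRing.residue 𝒪[K])) *ᵥ (p.elim (Pi.single 2 1) fun q => ![(1 : 𝓀[K]), q.1.1, q.1.2])))} =>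
      (⟨f p.1, (hf p.1).1, (hkey p.1).2 p.2⟩ :
        {w | w ∈ (latticeGraph σ ϖ ((StdForm.antidiagonal 3).over K)).neighborSet ⟨stdLattice K 3, 0, isSelfDualLattice_stdLattice_three_of_v hϖ⟩ ∧
          ∃ κ : unitaryGroupOfForm σ ((StdForm.antidiagonal 3).over K), κ ∈ unitaryInt σ ((StdForm.antidiagonal 3).over K) ∧
            w.1 = mapGL (κ : GL (Fin 3) K) (latt (Matrix.diagonal ![(1 : K), 1, ϖ])) ∧
            ∃ t : 𝒪[K], (t : K) = (ϖ ^ d)⁻¹ * B₀ σ 3 (((κ : GL (Fin 3) K) : Matrix (Fin 3) (Fin 3) K) *ᵥ (Pi.single 0 1))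
                (M *ᵥ (((κ : GL (Fin 3) K) : Matrix (Fin 3) (Fin 3) K) *ᵥ (Pi.single 0 1))) ∧ P (IsLocalRing.residue 𝒪[K] t)}))
    ⟨?_, ?_⟩)).symm
  · intro p p' hpp'
    exact Subtype.ext (hinj _ _ (congrArg Subtype.val hpp'))
  · rintro ⟨w, hw, hpass⟩
    obtain ⟨p, hp⟩ := hsurj w hw
    refine ⟨⟨p, (hkey p).1 (by rw [hp]; exact hpass)⟩, Subtype.ext hp⟩

/-- **THE PREDICATE ν-BRIDGE AT A GENERAL SELF-DUAL VERTEX `v = u·L₀`** (transport of the root statement along `u`, as ★ G3′∕G3): the neighbours of `u·L₀` are the `(uκ)·N₁`,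
`κ ∈ K₀`, and the test is read in the frame `κ` on the matrix `M` the consumer attaches to `u` (typically `M = u⁻¹γu − 1`). [cite: BruhatTits1972, §10] [cite: Tits1979, §3.5]
[cite: Kottwitz1986, §3] -/
theorem ncard_neighborSet_pred_eq_natCard (hσ : ∀ x, σ (σ x) = x) (hvσ : ∀ a, Valued.v (σ a) = Valued.v a) (hσϖ : σ ϖ = -ϖ)
    (hϖ : Valued.v ϖ = WithZero.exp (-1 : ℤ)) (hres : ∀ x : K, Valued.v x ≤ 1 → Valued.v (σ x - x) < 1) (h2 : Valued.v (2 : K) = 1) [Finite 𝓀[K]]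
    (u : unitaryGroupOfForm σ ((StdForm.antidiagonal 3).over K))
    {d : ℕ} (M : Matrix (Fin 3) (Fin 3) K) (Y₀ : Matrix (Fin 3) (Fin 3) 𝒪[K]) (hY₀ : ∀ i j, ((Y₀ i j : 𝒪[K]) : K) = (ϖ ^ d)⁻¹ * M i j)
    (P : 𝓀[K] → Prop) (hP : ∀ c t : 𝓀[K], c ≠ 0 → (P (c * c * t) ↔ P t)) :
    {c | c ∈ (latticeGraph σ ϖ ((StdForm.antidiagonal 3).over K)).neighborSet
          (latticeGraphIso σ ϖ ((StdForm.antidiagonal 3).over K) u ⟨stdLattice K 3, 0, isSelfDualLattice_stdLattice_three_of_v hϖ⟩) ∧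
        ∃ κ : unitaryGroupOfForm σ ((StdForm.antidiagonal 3).over K), κ ∈ unitaryInt σ ((StdForm.antidiagonal 3).over K) ∧
          c.1 = mapGL (((u * κ : unitaryGroupOfForm σ ((StdForm.antidiagonal 3).over K)) : GL (Fin 3) K)) (latt (Matrix.diagonal ![(1 : K), 1, ϖ])) ∧
          ∃ t : 𝒪[K], (t : K) = (ϖ ^ d)⁻¹ * B₀ σ 3 (((κ : GL (Fin 3) K) : Matrix (Fin 3) (Fin 3) K) *ᵥ (Pi.single 0 1))
              (M *ᵥ (((κ : GL (Fin 3) K) : Matrix (Fin 3) (Fin 3) K) *ᵥ (Pi.single 0 1))) ∧ P (IsLocalRing.residue 𝒪[K] t)}.ncard =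
      Nat.card {p : Option {p : 𝓀[K] × 𝓀[K] // p.2 + (RingHom.id 𝓀[K]) p.2 + p.1 * (RingHom.id 𝓀[K]) p.1 = 0} //
        P ((p.elim (Pi.single 2 1) fun q => ![(1 : 𝓀[K]), q.1.1, q.1.2]) ⬝ᵥ
          ((((StdForm.antidiagonal 3).over 𝓀[K]) * Y₀.map (IsLocalRing.residue 𝒪[K])) *ᵥ (p.elim (Pi.single 2 1) fun q => ![(1 : 𝓀[K]), q.1.1, q.1.2])))} := by
  rw [← ncard_neighborSet_root_pred_eq_natCard hσ hvσ hσϖ hϖ hres h2 M Y₀ hY₀ P hP]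
  have hmul : ∀ κ : unitaryGroupOfForm σ ((StdForm.antidiagonal 3).over K),
      mapGL (((u * κ : unitaryGroupOfForm σ ((StdForm.antidiagonal 3).over K)) : GL (Fin 3) K)) (latt (Matrix.diagonal ![(1 : K), 1, ϖ])) =
        mapGL (u : GL (Fin 3) K) (mapGL (κ : GL (Fin 3) K) (latt (Matrix.diagonal ![(1 : K), 1, ϖ]))) := fun κ => by
    rw [Subgroup.coe_mul, mapGL_mul]
  have hinvmul : ∀ X : Submodule 𝒪[K] (Fin 3 → K), mapGL ((u⁻¹ : unitaryGroupOfForm σ ((StdForm.antidiagonal 3).over K)) : GL (Fin 3) K) (mapGL (u : GL (Fin 3) K) X) = X :=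
    fun X => by rw [← mapGL_mul, Subgroup.coe_inv, inv_mul_cancel, mapGL_one]
  have himage : {c | c ∈ (latticeGraph σ ϖ ((StdForm.antidiagonal 3).over K)).neighborSet
          (latticeGraphIso σ ϖ ((StdForm.antidiagonal 3).over K) u ⟨stdLattice K 3, 0, isSelfDualLattice_stdLattice_three_of_v hϖ⟩) ∧
        ∃ κ : unitaryGroupOfForm σ ((StdForm.antidiagonal 3).over K), κ ∈ unitaryInt σ ((StdForm.antidiagonal 3).over K) ∧
          c.1 = mapGL (((u * κ : unitaryGroupOfForm σ ((StdForm.antidiagonal 3).over K)) : GL (Fin 3) K)) (latt (Matrix.diagonal ![(1 : K), 1, ϖ])) ∧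
          ∃ t : 𝒪[K], (t : K) = (ϖ ^ d)⁻¹ * B₀ σ 3 (((κ : GL (Fin 3) K) : Matrix (Fin 3) (Fin 3) K) *ᵥ (Pi.single 0 1))
              (M *ᵥ (((κ : GL (Fin 3) K) : Matrix (Fin 3) (Fin 3) K) *ᵥ (Pi.single 0 1))) ∧ P (IsLocalRing.residue 𝒪[K] t)} =
      latticeGraphIso σ ϖ ((StdForm.antidiagonal 3).over K) u ''
        {w | w ∈ (latticeGraph σ ϖ ((StdForm.antidiagonal 3).over K)).neighborSet ⟨stdLattice K 3, 0, isSelfDualLattice_stdLattice_three_of_v hϖ⟩ ∧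
          ∃ κ : unitaryGroupOfForm σ ((StdForm.antidiagonal 3).over K), κ ∈ unitaryInt σ ((StdForm.antidiagonal 3).over K) ∧
            w.1 = mapGL (κ : GL (Fin 3) K) (latt (Matrix.diagonal ![(1 : K), 1, ϖ])) ∧
            ∃ t : 𝒪[K], (t : K) = (ϖ ^ d)⁻¹ * B₀ σ 3 (((κ : GL (Fin 3) K) : Matrix (Fin 3) (Fin 3) K) *ᵥ (Pi.single 0 1))
                (M *ᵥ (((κ : GL (Fin 3) K) : Matrix (Fin 3) (Fin 3) K) *ᵥ (Pi.single 0 1))) ∧ P (IsLocalRing.residue 𝒪[K] t)} := by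
    ext c
    simp only [Set.mem_setOf_eq, Set.mem_image, SimpleGraph.mem_neighborSet]
    constructor
    · rintro ⟨hadj, κ, hκ, hcκ, ht⟩
      have hc : latticeGraphIso σ ϖ ((StdForm.antidiagonal 3).over K) u (latticeGraphIso σ ϖ ((StdForm.antidiagonal 3).over K) u⁻¹ c) = c :=
        latticeGraphIso_mul_inv_apply u c
      refine ⟨latticeGraphIso σ ϖ ((StdForm.antidiagonal 3).over K) u⁻¹ c, ⟨?_, κ, hκ, ?_, ht⟩, hc⟩
      · rw [← hc] at hadj
        exact (latticeGraphIso σ ϖ ((StdForm.antidiagonal 3).over K) u).map_adj_iff.1 hadj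
      · rw [latticeGraphIso_apply_val, hcκ, hmul, hinvmul]
    · rintro ⟨w, ⟨hadj, κ, hκ, hwκ, ht⟩, rfl⟩
      refine ⟨(latticeGraphIso σ ϖ ((StdForm.antidiagonal 3).over K) u).map_adj_iff.2 hadj, κ, hκ, ?_, ht⟩
      rw [latticeGraphIso_apply_val, hwκ, hmul]
  rw [himage, Set.ncard_image_of_injective _ (latticeGraphIso σ ϖ ((StdForm.antidiagonal 3).over K) u).injective]

/-! ## §3 Corollaries over ★ G3″ ∕ ★ G3‴: the numbers `2 ∕ 1` (null test) and `(q − 1)∕2` per class ∕ `q ∕ 0` (class test) -/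

section Values

/-- `|2| = 1` ⇒ `2 ≠ 0` in the residue field (as in ★ R2b). [cite: Tits1979, §3.5] -/
private theorem residue_two_ne_zero_G3 (h2 : Valued.v (2 : K) = 1) : (2 : 𝓀[K]) ≠ 0 := by
  rw [show (2 : 𝓀[K]) = IsLocalRing.residue 𝒪[K] 2 from (map_ofNat _ 2).symm, Ne, residue_eq_zero_iff_v_lt_one]
  exact fun hlt => absurd (show Valued.v (2 : K) < 1 from hlt) (by rw [h2]; exact lt_irrefl 1)

/-- `|2| = 1` ⇒ the residue field has characteristic `≠ 2`. [cite: Tits1979, §3.5] -/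
private theorem ringChar_residueField_ne_two_G3 (h2 : Valued.v (2 : K) = 1) : ringChar 𝓀[K] ≠ 2 := by
  intro hc
  apply residue_two_ne_zero_G3 (K := K) h2
  have h := (ringChar.spec 𝓀[K] 2).2 (by rw [hc])
  exact_mod_cast h

/-- **THE NULL TEST AT DEPTH `d`, RANK TWO: exactly `2` neighbours** of `L₀` have a `Q_Ȳ`-null line, when `Ȳ = (ϖ^d)⁻¹M mod ϖ` is `J̄₀`-symmetric with `Ȳ³ = 0 ≠ Ȳ²`
(★ G3″ `natCard_nullParams_eq_two_of_sq_ne_zero`; ★ G3′'s `ν = 2` is the case `d = 1` phrased through «passing»). [cite: BruhatTits1972, §10] [cite: Kottwitz1986, §3] -/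
theorem ncard_neighborSet_root_null_eq_two_of_sq_ne_zero (hσ : ∀ x, σ (σ x) = x) (hvσ : ∀ a, Valued.v (σ a) = Valued.v a) (hσϖ : σ ϖ = -ϖ)
    (hϖ : Valued.v ϖ = WithZero.exp (-1 : ℤ)) (hres : ∀ x : K, Valued.v x ≤ 1 → Valued.v (σ x - x) < 1) (h2 : Valued.v (2 : K) = 1) [Finite 𝓀[K]]
    {d : ℕ} (M : Matrix (Fin 3) (Fin 3) K) (Y₀ : Matrix (Fin 3) (Fin 3) 𝒪[K]) (hY₀ : ∀ i j, ((Y₀ i j : 𝒪[K]) : K) = (ϖ ^ d)⁻¹ * M i j)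
    (hYs : ((StdForm.antidiagonal 3).over 𝓀[K])⁻¹ * ((Y₀.map (IsLocalRing.residue 𝒪[K])).map (RingHom.id 𝓀[K]))ᵀ * (StdForm.antidiagonal 3).over 𝓀[K] =
      Y₀.map (IsLocalRing.residue 𝒪[K]))
    (h3 : Y₀.map (IsLocalRing.residue 𝒪[K]) ^ 3 = 0) (hsq : Y₀.map (IsLocalRing.residue 𝒪[K]) * Y₀.map (IsLocalRing.residue 𝒪[K]) ≠ 0) :
    {w | w ∈ (latticeGraph σ ϖ ((StdForm.antidiagonal 3).over K)).neighborSet ⟨stdLattice K 3, 0, isSelfDualLattice_stdLattice_three_of_v hϖ⟩ ∧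
        ∃ κ : unitaryGroupOfForm σ ((StdForm.antidiagonal 3).over K), κ ∈ unitaryInt σ ((StdForm.antidiagonal 3).over K) ∧
          w.1 = mapGL (κ : GL (Fin 3) K) (latt (Matrix.diagonal ![(1 : K), 1, ϖ])) ∧
          ∃ t : 𝒪[K], (t : K) = (ϖ ^ d)⁻¹ * B₀ σ 3 (((κ : GL (Fin 3) K) : Matrix (Fin 3) (Fin 3) K) *ᵥ (Pi.single 0 1))
              (M *ᵥ (((κ : GL (Fin 3) K) : Matrix (Fin 3) (Fin 3) K) *ᵥ (Pi.single 0 1))) ∧ IsLocalRing.residue 𝒪[K] t = 0}.ncard = 2 := by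
  rw [ncard_neighborSet_root_pred_eq_natCard hσ hvσ hσϖ hϖ hres h2 M Y₀ hY₀ (fun t => t = 0)
    (fun c t hc => by rw [mul_eq_zero, mul_eq_zero, or_self, or_iff_right hc])]
  exact natCard_nullParams_eq_two_of_sq_ne_zero (residue_two_ne_zero_G3 h2) hYs h3 hsq

/-- **THE NULL TEST AT DEPTH `d`, RANK ONE: exactly `1` neighbour** of `L₀` has a `Q_Ȳ`-null line, when `Ȳ` is `J̄₀`-symmetric with `Ȳ² = 0 ≠ Ȳ`
(★ G3″ `natCard_nullParams_eq_one_of_sq_eq_zero`). [cite: BruhatTits1972, §10] [cite: Kottwitz1986, §3] -/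
theorem ncard_neighborSet_root_null_eq_one_of_sq_eq_zero (hσ : ∀ x, σ (σ x) = x) (hvσ : ∀ a, Valued.v (σ a) = Valued.v a) (hσϖ : σ ϖ = -ϖ)
    (hϖ : Valued.v ϖ = WithZero.exp (-1 : ℤ)) (hres : ∀ x : K, Valued.v x ≤ 1 → Valued.v (σ x - x) < 1) (h2 : Valued.v (2 : K) = 1) [Finite 𝓀[K]]
    {d : ℕ} (M : Matrix (Fin 3) (Fin 3) K) (Y₀ : Matrix (Fin 3) (Fin 3) 𝒪[K]) (hY₀ : ∀ i j, ((Y₀ i j : 𝒪[K]) : K) = (ϖ ^ d)⁻¹ * M i j)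
    (hYs : ((StdForm.antidiagonal 3).over 𝓀[K])⁻¹ * ((Y₀.map (IsLocalRing.residue 𝒪[K])).map (RingHom.id 𝓀[K]))ᵀ * (StdForm.antidiagonal 3).over 𝓀[K] =
      Y₀.map (IsLocalRing.residue 𝒪[K]))
    (h0 : Y₀.map (IsLocalRing.residue 𝒪[K]) * Y₀.map (IsLocalRing.residue 𝒪[K]) = 0) (hne : Y₀.map (IsLocalRing.residue 𝒪[K]) ≠ 0) :
    {w | w ∈ (latticeGraph σ ϖ ((StdForm.antidiagonal 3).over K)).neighborSet ⟨stdLattice K 3, 0, isSelfDualLattice_stdLattice_three_of_v hϖ⟩ ∧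
        ∃ κ : unitaryGroupOfForm σ ((StdForm.antidiagonal 3).over K), κ ∈ unitaryInt σ ((StdForm.antidiagonal 3).over K) ∧
          w.1 = mapGL (κ : GL (Fin 3) K) (latt (Matrix.diagonal ![(1 : K), 1, ϖ])) ∧
          ∃ t : 𝒪[K], (t : K) = (ϖ ^ d)⁻¹ * B₀ σ 3 (((κ : GL (Fin 3) K) : Matrix (Fin 3) (Fin 3) K) *ᵥ (Pi.single 0 1))
              (M *ᵥ (((κ : GL (Fin 3) K) : Matrix (Fin 3) (Fin 3) K) *ᵥ (Pi.single 0 1))) ∧ IsLocalRing.residue 𝒪[K] t = 0}.ncard = 1 := by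
  rw [ncard_neighborSet_root_pred_eq_natCard hσ hvσ hσϖ hϖ hres h2 M Y₀ hY₀ (fun t => t = 0)
    (fun c t hc => by rw [mul_eq_zero, mul_eq_zero, or_self, or_iff_right hc])]
  exact natCard_nullParams_eq_one_of_sq_eq_zero hYs h0 hne

variable [Fintype 𝓀[K]] [DecidableEq 𝓀[K]]

/-- **THE CLASS SPLIT AT DEPTH `d`, RANK TWO: `2·#{neighbours of L₀ whose line has χ(c₀·Q_Ȳ) = σ} = q − 1`** (`σ = ±1`, `c₀ ≠ 0`; `Ȳ` `J̄₀`-symmetric with `Ȳ³ = 0 ≠ Ȳ²`) —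
the `hO` row's line count before the `q` lifts (★ G3‴ `two_mul_natCard_params_quadraticChar_eq_of_sq_ne_zero`). [cite: BruhatTits1972, §10] [cite: Kottwitz1986, §3] -/
theorem two_mul_ncard_neighborSet_root_quadraticChar_eq_of_sq_ne_zero (hσ : ∀ x, σ (σ x) = x) (hvσ : ∀ a, Valued.v (σ a) = Valued.v a) (hσϖ : σ ϖ = -ϖ)
    (hϖ : Valued.v ϖ = WithZero.exp (-1 : ℤ)) (hres : ∀ x : K, Valued.v x ≤ 1 → Valued.v (σ x - x) < 1) (h2 : Valued.v (2 : K) = 1)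
    {d : ℕ} (M : Matrix (Fin 3) (Fin 3) K) (Y₀ : Matrix (Fin 3) (Fin 3) 𝒪[K]) (hY₀ : ∀ i j, ((Y₀ i j : 𝒪[K]) : K) = (ϖ ^ d)⁻¹ * M i j)
    (hYs : ((StdForm.antidiagonal 3).over 𝓀[K])⁻¹ * ((Y₀.map (IsLocalRing.residue 𝒪[K])).map (RingHom.id 𝓀[K]))ᵀ * (StdForm.antidiagonal 3).over 𝓀[K] =
      Y₀.map (IsLocalRing.residue 𝒪[K]))
    (h3 : Y₀.map (IsLocalRing.residue 𝒪[K]) ^ 3 = 0) (hsq : Y₀.map (IsLocalRing.residue 𝒪[K]) * Y₀.map (IsLocalRing.residue 𝒪[K]) ≠ 0)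
    {c₀ : 𝓀[K]} (hc₀ : c₀ ≠ 0) {s : ℤ} (hs : s = 1 ∨ s = -1) :
    2 * {w | w ∈ (latticeGraph σ ϖ ((StdForm.antidiagonal 3).over K)).neighborSet ⟨stdLattice K 3, 0, isSelfDualLattice_stdLattice_three_of_v hϖ⟩ ∧
        ∃ κ : unitaryGroupOfForm σ ((StdForm.antidiagonal 3).over K), κ ∈ unitaryInt σ ((StdForm.antidiagonal 3).over K) ∧
          w.1 = mapGL (κ : GL (Fin 3) K) (latt (Matrix.diagonal ![(1 : K), 1, ϖ])) ∧
          ∃ t : 𝒪[K], (t : K) = (ϖ ^ d)⁻¹ * B₀ σ 3 (((κ : GL (Fin 3) K) : Matrix (Fin 3) (Fin 3) K) *ᵥ (Pi.single 0 1))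
              (M *ᵥ (((κ : GL (Fin 3) K) : Matrix (Fin 3) (Fin 3) K) *ᵥ (Pi.single 0 1))) ∧ quadraticChar 𝓀[K] (c₀ * IsLocalRing.residue 𝒪[K] t) = s}.ncard =
      Nat.card 𝓀[K] - 1 := by
  rw [ncard_neighborSet_root_pred_eq_natCard hσ hvσ hσϖ hϖ hres h2 M Y₀ hY₀ (fun t => quadraticChar 𝓀[K] (c₀ * t) = s)
    (fun c t hc => by rw [show c₀ * (c * c * t) = c ^ 2 * (c₀ * t) by ring, map_mul, quadraticChar_sq_one' hc, one_mul])]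
  exact two_mul_natCard_params_quadraticChar_eq_of_sq_ne_zero (ringChar_residueField_ne_two_G3 h2) hYs h3 hsq hc₀ hs

/-- **THE CLASS TEST AT DEPTH `d`, RANK ONE: `#{neighbours of L₀ whose line has χ(c₀·Q_Ȳ) = σ} = q` if `χ(c₀c) = σ`, else `0`**, when `ḡȲḡ⁻¹ = N(c)` for some `ḡ ∈ O(J̄₀)`
(`σ = ±1`) — the `hP` row's line count (★ G3‴ `natCard_params_quadraticChar_eq_ite_of_conj_cornerSymmetric`). [cite: BruhatTits1972, §10] [cite: Kottwitz1986, §3] -/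
theorem ncard_neighborSet_root_quadraticChar_eq_ite_of_conj_cornerSymmetric (hσ : ∀ x, σ (σ x) = x) (hvσ : ∀ a, Valued.v (σ a) = Valued.v a) (hσϖ : σ ϖ = -ϖ)
    (hϖ : Valued.v ϖ = WithZero.exp (-1 : ℤ)) (hres : ∀ x : K, Valued.v x ≤ 1 → Valued.v (σ x - x) < 1) (h2 : Valued.v (2 : K) = 1)
    {d : ℕ} (M : Matrix (Fin 3) (Fin 3) K) (Y₀ : Matrix (Fin 3) (Fin 3) 𝒪[K]) (hY₀ : ∀ i j, ((Y₀ i j : 𝒪[K]) : K) = (ϖ ^ d)⁻¹ * M i j)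
    {g : GL (Fin 3) 𝓀[K]} (hg : g ∈ unitaryGroupOfForm (RingHom.id 𝓀[K]) ((StdForm.antidiagonal 3).over 𝓀[K])) {c : 𝓀[K]}
    (hY : (g : Matrix (Fin 3) (Fin 3) 𝓀[K]) * Y₀.map (IsLocalRing.residue 𝒪[K]) * ((g⁻¹ : GL (Fin 3) 𝓀[K]) : Matrix (Fin 3) (Fin 3) 𝓀[K]) = !![0, 0, 0; 0, 0, 0; c, 0, 0])
    (c₀ : 𝓀[K]) {s : ℤ} (hs : s = 1 ∨ s = -1) :
    {w | w ∈ (latticeGraph σ ϖ ((StdForm.antidiagonal 3).over K)).neighborSet ⟨stdLattice K 3, 0, isSelfDualLattice_stdLattice_three_of_v hϖ⟩ ∧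
        ∃ κ : unitaryGroupOfForm σ ((StdForm.antidiagonal 3).over K), κ ∈ unitaryInt σ ((StdForm.antidiagonal 3).over K) ∧
          w.1 = mapGL (κ : GL (Fin 3) K) (latt (Matrix.diagonal ![(1 : K), 1, ϖ])) ∧
          ∃ t : 𝒪[K], (t : K) = (ϖ ^ d)⁻¹ * B₀ σ 3 (((κ : GL (Fin 3) K) : Matrix (Fin 3) (Fin 3) K) *ᵥ (Pi.single 0 1))
              (M *ᵥ (((κ : GL (Fin 3) K) : Matrix (Fin 3) (Fin 3) K) *ᵥ (Pi.single 0 1))) ∧ quadraticChar 𝓀[K] (c₀ * IsLocalRing.residue 𝒪[K] t) = s}.ncard =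
      if quadraticChar 𝓀[K] (c₀ * c) = s then Nat.card 𝓀[K] else 0 := by
  by_cases hc₀ : c₀ = 0
  · have hs0 : (0 : ℤ) ≠ s := by rcases hs with rfl | rfl <;> decide
    subst hc₀
    simp only [zero_mul, quadraticChar_zero, if_neg hs0]
    convert Set.ncard_empty ({L : Submodule 𝒪[K] (Fin 3 → K) // IsVertex σ ϖ ((StdForm.antidiagonal 3).over K) L}) using 2
    ext w
    simp only [Set.mem_setOf_eq, Set.mem_empty_iff_false, iff_false, not_and, not_exists]
    intro _ κ _ _ t _ h
    exact hs0 h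
  rw [ncard_neighborSet_root_pred_eq_natCard hσ hvσ hσϖ hϖ hres h2 M Y₀ hY₀ (fun t => quadraticChar 𝓀[K] (c₀ * t) = s)
    (fun c t hc => by rw [show c₀ * (c * c * t) = c ^ 2 * (c₀ * t) by ring, map_mul, quadraticChar_sq_one' hc, one_mul])]
  exact natCard_params_quadraticChar_eq_ite_of_conj_cornerSymmetric (ringChar_residueField_ne_two_G3 h2) hg hY c₀ hs

end Values

end Literature.NumberTheory.Automorphic.UnitaryLatticeTree

end
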